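import Literature.AlgebraicGeometry.Resolution.IsolatedOrderPoint
import Literature.AlgebraicGeometry.Resolution.HilbertSamuelLocal
import Literature.AlgebraicGeometry.CossartJannsenSaito2020.KeyTheoremsIsolated
import HarnessLib

/-!
# [OURS · L1 W4.2] Bricks for C4 P1 `AlgIsolatedOfIsolated` (W4.2 DEAL D15 «P1 PROOF»; crux `SigmaMaxModifications`
# stmt-ResolutionOfSingularities-18506, conjunct `SigmaMaxModificationsCorridor3` stmt-…-19249; `--supports stmt-…-19249`, helper)
# — part 2: the SCHEME side — generisations from primes of the stalk with their Hilbert–Samuel functions, and «an isolated point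
# of the Hilbert–Samuel locus has no proper generisation of Hilbert–Samuel function `≥`»

OURS (cell res-hironaka, slot W4.2, seat res-D-pv-042 AS W4.2 DEAL hand D15); NOT statements of H. Hironaka's manuscript
[Hironaka2017] nor of [CossartJannsenSaito2020]. AI-drafted, weaker than expert review. Sorry-free PROOF file (no new definition),
fact-free.

* `exists_specializes_hsFun_eq_of_prime` — **a non-maximal prime `𝔮` of `𝒪_{X,x}` is the maximal ideal of a proper generisation
  `ζ ⤳ x`, `ζ ≠ x`, with `𝒪_{X,ζ} ≅ (𝒪_{X,x})_𝔮`**, so `H^N_X(ζ) = H^{(N − ψ((𝒪_{X,x})_𝔮))}[(𝒪_{X,x})_𝔮]` for every `N` (Stacks 01J7;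
  tree `exists_specializes_comap_stalkSpecializes_eq`, `isLocalizationAtPrime_stalkSpecializes`).
* `eq_of_isIsolatedInHSMaxLocus_of_hsFun_le` — **if `x` is isolated in `X_max` (CJS Def. 13.3) then a generisation `ζ ⤳ x` with
  `H^N_X(x) ≤ H^N_X(ζ)` IS `x`**: `H_X(x)` is maximal, so `H_X(ζ) = H_X(x)` is maximal, `ζ ∈ X_max`, and `ζ` lies in every open
  neighbourhood of `x`. (The argument (A) of `Moving.isIsolatedInHSMaxLocus_of_spec`, p513521, as a stand-alone lemma.)
* `not_hsFun_le_of_isIsolatedInHSMaxLocus` — contrapositive packaging for a non-maximal prime: the residual ALGEBRAIC content of P1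
  is thus «a non-maximal prime `𝔮` of `𝒪_{Y,y}` with `H^{(3−ψ)}[(𝒪_{Y,y})_𝔮] ≥ H^{(3−ψ)}[𝒪_{Y,y}]`», which part 1 (regular
  homomorphisms) and the hypersurface computation along `V(X̄, ū_a, ū_b)` supply.

## References

* The Stacks Project, Tag 01J7 (points of `Spec 𝒪_{X,x}`). [StacksProject]
* V. Cossart, U. Jannsen, S. Saito, LNM 2270 (2020): Def. 2.28, Def. 2.35, Def. 13.3. [CossartJannsenSaito2020]
-/

noncomputable section

set_option linter.dupNamespace false -- mandated namespace of this single-conjunct summit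

open CategoryTheory AlgebraicGeometry TopologicalSpace IsLocalRing
open Literature.AlgebraicGeometry.Resolution Literature.RingTheory.HilbertSamuel
open Literature.AlgebraicGeometry.CossartJannsenSaito2020

universe u

namespace Summit.ResolutionOfSingularities.ResolutionOfSingularities.Cruxes.SigmaMaxModifications.IdeasL1C4

variable {X : Scheme.{u}} [IsLocallyNoetherian X]

/-- **A non-maximal prime of the stalk is a proper generisation, with the expected Hilbert–Samuel function.** For a prime
`𝔮 ≠ 𝔪_x` of `𝒪_{X,x}` there is `ζ ⤳ x`, `ζ ≠ x`, with `𝒪_{X,ζ} ≅ (𝒪_{X,x})_𝔮`, hence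
`H^N_X(ζ) = H^{(N − ψ((𝒪_{X,x})_𝔮))}[(𝒪_{X,x})_𝔮]` for every `N`. [cite: StacksProject, Tag 01J7]
[cite: CossartJannsenSaito2020, Def. 2.28] -/
theorem exists_specializes_hsFun_eq_of_prime (x : X) (𝔮 : Ideal (X.presheaf.stalk x)) [𝔮.IsPrime]
    (h𝔮 : 𝔮 ≠ maximalIdeal _) :
    ∃ ζ : X, ζ ⤳ x ∧ ζ ≠ x ∧ Nonempty (X.presheaf.stalk ζ ≃+* Localization.AtPrime 𝔮) ∧
      ∀ N : ℕ, Scheme.hsFun X N ζ =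
        hilbertSamuelFun (Localization.AtPrime 𝔮) (N - minimalPrimesCodim (Localization.AtPrime 𝔮)) := by
  obtain ⟨ζ, hζx, hP⟩ := exists_specializes_comap_stalkSpecializes_eq x 𝔮
  have hζne : ζ ≠ x := by
    rintro rfl
    exact h𝔮 (hP.trans (comap_stalkSpecializes_refl_maximalIdeal ζ))
  letI := (X.presheaf.stalkSpecializes hζx).hom.toAlgebra
  haveI hloc := isLocalizationAtPrime_stalkSpecializes hζx
  subst hP
  let e : Localization.AtPrime ((maximalIdeal (X.presheaf.stalk ζ)).comap
      (X.presheaf.stalkSpecializes hζx).hom) ≃ₐ[X.presheaf.stalk x] X.presheaf.stalk ζ :=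
    IsLocalization.algEquiv
      ((maximalIdeal (X.presheaf.stalk ζ)).comap (X.presheaf.stalkSpecializes hζx).hom).primeCompl _ _
  refine ⟨ζ, hζx, hζne, ⟨e.toRingEquiv.symm⟩, fun N => ?_⟩
  rw [Scheme.hsFun_def, Scheme.hsPsi, minimalPrimesCodim_eq_of_ringEquiv e.toRingEquiv.symm,
    hilbertSamuelFun_eq_of_ringEquiv e.toRingEquiv.symm]

/-- **An isolated point of the Hilbert–Samuel locus has no proper generisation of Hilbert–Samuel function `≥` its own**: if `x` is
isolated in `X_max` (some open `U` meets `X_max` exactly in `x`), `ζ ⤳ x` and `H^N_X(x) ≤ H^N_X(ζ)`, then `ζ = x` — `H_X(x)` is a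
maximal value, so `H_X(ζ) = H_X(x)`, `ζ ∈ X_max`, and `ζ ∈ U` since opens are stable under generisation.
[cite: CossartJannsenSaito2020, Def. 13.3, Def. 2.35] -/
theorem eq_of_isIsolatedInHSMaxLocus_of_hsFun_le {N : ℕ} {x : X} (hiso : IsIsolatedInHSMaxLocus X N x) {ζ : X}
    (hζ : ζ ⤳ x) (hle : Scheme.hsFun X N x ≤ Scheme.hsFun X N ζ) : ζ = x := by
  obtain ⟨U, hU, hUx⟩ := hiso
  have hx : x ∈ U ∩ Scheme.hsMaxLocus X N := by rw [hUx]; exact Set.mem_singleton x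
  have hmax : Maximal (· ∈ Scheme.hsValues X N) (Scheme.hsFun X N x) := Scheme.mem_hsMaxLocus_iff.mp hx.2
  have heq : Scheme.hsFun X N ζ = Scheme.hsFun X N x := le_antisymm (hmax.2 ⟨ζ, rfl⟩ hle) hle
  have hζmax : ζ ∈ Scheme.hsMaxLocus X N := by
    rw [Scheme.mem_hsMaxLocus_iff, heq]
    exact hmax
  have hζU : ζ ∈ U := hζ.mem_open hU hx.1
  have : ζ ∈ U ∩ Scheme.hsMaxLocus X N := ⟨hζU, hζmax⟩
  rw [hUx] at this
  exact this

/-- **The residual form of P1's scheme step**: at a point `x` isolated in `X_max` at level `N`, NO non-maximal prime `𝔮` of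
`𝒪_{X,x}` has `H^{(N − ψ((𝒪_{X,x})_𝔮))}[(𝒪_{X,x})_𝔮] ≥ H^N_X(x)`. [cite: CossartJannsenSaito2020, Def. 13.3, Def. 2.28]
[cite: StacksProject, Tag 01J7] -/
theorem not_hsFun_le_of_isIsolatedInHSMaxLocus {N : ℕ} {x : X} (hiso : IsIsolatedInHSMaxLocus X N x)
    (𝔮 : Ideal (X.presheaf.stalk x)) [𝔮.IsPrime] (h𝔮 : 𝔮 ≠ maximalIdeal _) :
    ¬ Scheme.hsFun X N x ≤
      hilbertSamuelFun (Localization.AtPrime 𝔮) (N - minimalPrimesCodim (Localization.AtPrime 𝔮)) := by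
  intro hle
  obtain ⟨ζ, hζx, hζne, -, hH⟩ := exists_specializes_hsFun_eq_of_prime x 𝔮 h𝔮
  rw [← hH N] at hle
  exact hζne (eq_of_isIsolatedInHSMaxLocus_of_hsFun_le hiso hζx hle)

end Summit.ResolutionOfSingularities.ResolutionOfSingularities.Cruxes.SigmaMaxModifications.IdeasL1C4

end
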